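import Summits.BirchSwinnertonDyer.BirchSwinnertonDyer.Theorems.PrintX10bBeyondCarrierUpperLinkOfPrint
import Summits.BirchSwinnertonDyer.BirchSwinnertonDyer.Theorems.PrintX10bBeyondCarrierDepthOfUpperLink
import HarnessLib

/-!
# Crux `BeyondCarrierDepthX10b` (stmt-BirchSwinnertonDyer-23055, `route-BirchSwinnertonDyer-PrintX10b`
# rev 19): the three stubs of the registered skeleton v5 (fc3088a6, line «twins» re-cut on the one-sided
# link U₃) BY SIGNATURE modulo named facts, and the crux BY NAME from its ONE open stub

HONEST FRAMING (cell `run/shared/lean/pub/bsd-print-x9/`, LEAD seat bsd-line-x10b-p1 of the registered line on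
crux 23055, D-0154 KEY row 10): THEOREMS ONLY, conditional glue, nothing booked, nothing closed — one-line
re-packagings of x10b-p1-w2's landed theorems (`…UpperHalf.upperLinkX10b_coprimeClassNumber_of_namedFacts`,
`PrintX10bBeyondCarrierUpperLinkOfPrint.lean`; `…UpperHalf.beyondCarrierDepthX10b_of_namedFacts_of_upperLink`,
p607624) in the LETTER of the v5 stubs, so that the ledger's helper list and the skeleton's stub list agree
by name and signature, plus the composition. The OPEN content of the crux is untouched and is exactly the
hypothesis `h₂` of the last theorem: `stub_upperLink_divisibleClassNumber` = the one-sided link U₃ («Selmer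
is small», the Euler-system half of the anticyclotomic BDP / Heegner-point main conjecture at the trivial
character, integrally) on the X10b Heegner frames with `3 ∣ h_K` — beyond print at `p = 3` under (irr) +
¬Surj (cell DOSSIER §41.12–41.13; plan g9 FINDING PIN-1 §5). Cite-only facts used: `h46` (Mastella–Zerman
2026 Cor. 4.6), `hYZ` (the Yan–Zhu/BCS/CGLS composite — flagged «layout: unpinned family» by PIN-1, to be
replaced by its pinned re-typing (T1); used ONLY on the `3 ∤ h_K` frames), `h331` (JSW 2017 Thm. 3.3.1),
`hChaL` (Cha 2005 Rmk. 25 lower half), `hKo` (Kolyvagin 1990 Thm. A). «beyond-print theorem»: NO.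
BSD is not proved by any of this; no summit statement is proved by this seat.

* `stub_upperLink_coprimeClassNumber_of_namedFacts (h46 hYZ h331)` — v5 stub₁ VERBATIM (binder reorder of w2's theorem).
* `stub_beyondCarrier_of_upperLink_of_namedFacts (h331 hChaL hKo)` — v5 stub₃ VERBATIM (= w2's door).
* `beyondCarrierDepthX10b_of_upperLinkDivisible_of_namedFacts (h46 hYZ h331 hChaL hKo) (h₂ : stub₂)` —
  **the census theorem**: the crux BY NAME from its ONE open stub and five cite-only facts (numbers: 1 open
  statement; 5 facts, of which 2 — h46, hYZ — serve only the `3 ∤ h_K` frames and 1 — hChaL — is not a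
  `closes` binder of PrintX10b rev 19).

References: [MastellaZerman2026] Cor. 4.6; [YanZhu2024MainConjNonCM] Thm. 5.7 (1), 5.9; [BurungaleCastellaSkinner2025]
Prop. 4.2.2; [CastellaGrossiLeeSkinner2022] Thm. 5.1.3; [JetchevSkinnerWan2017] Thm. 3.3.1; [Cha2005] Rmk. 25;
[Kolyvagin1990] Thm. A; [Castella2018] Thm. 2.3, §5; skeleton v5 `Cruxes/BeyondCarrierDepthX10b/Lines/twins.lean`.
-/

-- the REGISTERED stub namespace `Summit.BirchSwinnertonDyer.BirchSwinnertonDyer.Cruxes.…` repeats the summit name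
set_option linter.dupNamespace false
set_option autoImplicit false

noncomputable section

open scoped Classical

open WeierstrassCurve NumberField
  Literature.NumberTheory.EllipticCurves Literature.NumberTheory.EllipticCurves.ModularForms
  Literature.NumberTheory.EllipticCurves.JetchevSkinnerWan2017
  Literature.NumberTheory.EllipticCurves.YanZhu2026
  Summit.BirchSwinnertonDyer.Rank1Residual
  Summit.BirchSwinnertonDyer.BirchSwinnertonDyer.Theses.PrintX10b
  Summit.BirchSwinnertonDyer.BirchSwinnertonDyer.Cruxes.BeyondCarrierDepthX10b

namespace Summit.BirchSwinnertonDyer.BirchSwinnertonDyer.Cruxes.BeyondCarrierDepthX10b.HowardFrames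

/-- **v5 stub₁ `stub_upperLink_coprimeClassNumber` BY SIGNATURE modulo three cite-only facts**: the
one-sided link U₃ on the X10b Heegner frames with `3 ∤ h_K`, from Mastella–Zerman Cor. 4.6 (`h46`), the
Yan–Zhu/BCS/CGLS composite (`hYZ`; unpinned layout — PIN-1) and JSW Thm. 3.3.1 (`h331`) — x10b-p1-w2's
`UpperHalf.upperLinkX10b_coprimeClassNumber_of_namedFacts` with the class-number binder moved before (irr_K).
[cite: MastellaZerman2026, Cor. 4.6] [cite: YanZhu2024MainConjNonCM, Thm. 5.7 (1), Thm. 5.9]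
[cite: JetchevSkinnerWan2017, Thm. 3.3.1] [cite: Castella2018, §5 (eq:IMC+BDP)] -/
theorem stub_upperLink_coprimeClassNumber_of_namedFacts
    (h46 : MastellaZerman2026.cor46_howardDivisibility_of_scalarImage.{0})
    (hYZ : thm57_thm59_bcs422_cgls513_generator_constantCoeff_of_heegnerDivisibility)
    (h331 : thm331_anticyclotomicControl) :
    ∀ (W : WeierstrassCurve ℚ) [W.IsElliptic] [W.IsGloballyMinimal] (p : ℕ) [Fact p.Prime]
    [NeZero (W.conductorNorm ℤ)] (K : Type) [Field K] [NumberField K],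
    Literature.NumberTheory.EllipticCurves.Rank1Residual.ClassX10 W p →
    ¬ Literature.NumberTheory.EllipticCurves.Rank1Residual.Surj W 3 → ¬ W.HasCM →
    Literature.NumberTheory.EllipticCurves.IsImaginaryQuadratic K → Odd (NumberField.discr K) →
    NumberField.discr K ≠ -3 →
    Literature.NumberTheory.EllipticCurves.SatisfiesHeegnerHypothesis (W.conductorNorm ℤ) K →
    Literature.NumberTheory.EllipticCurves.SatisfiesHeegnerHypothesis p K →
    ¬ p ∣ NumberField.classNumber K →
    (W.baseChange K).HasIrreducibleModPGaloisRep p →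
    ∀ (ι : K →+* ℚ_[p]) (κ : Literature.NumberTheory.EllipticCurves.ZpExtension K p), κ.IsAnticyclotomic →
    ∀ (γ : Field.absoluteGaloisGroup K) [Fact (κ.IsTopGenerator γ)]
    (Dt : Literature.NumberTheory.EllipticCurves.ModularForms.ModularParametrizationData W
    (W.conductorNorm ℤ)), ¬ (p : ℤ) ∣ Dt.c →
    ∀ (H : Literature.NumberTheory.EllipticCurves.HeegnerDatum (W.conductorNorm ℤ) (NumberField.discr K))
    (ιC : K →+* ℂ) (P : (W.baseChange K).toAffine.Point),
    WeierstrassCurve.Affine.Point.map ιC.toRatAlgHom P =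
    Literature.NumberTheory.EllipticCurves.ModularForms.heegnerPointComplex Dt H →
    (W.baseChange K).mordellWeilRank = 1 →
    Finite (AddCommGroup.primaryComponent (W.baseChange K).sha p) → ¬ IsOfFinAddOrder P →
    ∃ n : ℕ, Summit.BirchSwinnertonDyer.Rank1Residual.X11b.AcSelmer.XAc.HasCharValuationAt
    (W.baseChange K) p κ (Summit.BirchSwinnertonDyer.Rank1Residual.X11b.inducedPlace ι) ∅ γ n ∧
    (n : ℤ) ≤ 2 * (Summit.BirchSwinnertonDyer.Rank1Residual.X11b.padicLogOrd W p ι P +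
    (padicValInt p (1 - W.frobeniusTrace p + p) : ℤ) - 1) := by
  intro W _ _ p _ _ K _ _ hX hns hcm hK hodd h3 hHN hHp hh hirr ι κ hκ γ _ Dt hc H ιC P hP hrk hfin hPinf
  exact UpperHalf.upperLinkX10b_coprimeClassNumber_of_namedFacts h46 hYZ h331 W p K hX hns hcm hK hodd h3
    hHN hHp hirr hh ι κ hκ γ Dt hc H ιC P hP hrk hfin hPinf

/-- **v5 stub₃ `stub_beyondCarrier_of_upperLink` BY SIGNATURE modulo three cite-only facts** (`h331` JSW
Thm. 3.3.1, `hChaL` Cha Rmk. 25 lower half, `hKo` Kolyvagin Thm. A): U₃ gives the body of the crux —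
x10b-p1-w2's `UpperHalf.beyondCarrierDepthX10b_of_namedFacts_of_upperLink` verbatim.
[cite: JetchevSkinnerWan2017, Thm. 3.3.1] [cite: Cha2005, Thm. 21 and Rmk. 25] [cite: Kolyvagin1990, Thm. A] -/
theorem stub_beyondCarrier_of_upperLink_of_namedFacts
    (h331 : thm331_anticyclotomicControl)
    (hChaL : Cha2005.rmk25_pow_dvd_card_sha_primary_of_certificate)
    (hKo : ∀ (N : ℕ) [NeZero N] (W : WeierstrassCurve ℚ) (K : Type) [Field K] [NumberField K],
      kolyvagin N W K) :
    (∀ (W : WeierstrassCurve ℚ) [W.IsElliptic] [W.IsGloballyMinimal] (p : ℕ) [Fact p.Prime]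
    [NeZero (W.conductorNorm ℤ)] (K : Type) [Field K] [NumberField K],
    Literature.NumberTheory.EllipticCurves.Rank1Residual.ClassX10 W p →
    ¬ Literature.NumberTheory.EllipticCurves.Rank1Residual.Surj W 3 → ¬ W.HasCM →
    Literature.NumberTheory.EllipticCurves.IsImaginaryQuadratic K → Odd (NumberField.discr K) →
    NumberField.discr K ≠ -3 →
    Literature.NumberTheory.EllipticCurves.SatisfiesHeegnerHypothesis (W.conductorNorm ℤ) K →
    Literature.NumberTheory.EllipticCurves.SatisfiesHeegnerHypothesis p K →
    (W.baseChange K).HasIrreducibleModPGaloisRep p →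
    ∀ (ι : K →+* ℚ_[p]) (κ : Literature.NumberTheory.EllipticCurves.ZpExtension K p), κ.IsAnticyclotomic →
    ∀ (γ : Field.absoluteGaloisGroup K) [Fact (κ.IsTopGenerator γ)]
    (Dt : Literature.NumberTheory.EllipticCurves.ModularForms.ModularParametrizationData W
    (W.conductorNorm ℤ)), ¬ (p : ℤ) ∣ Dt.c →
    ∀ (H : Literature.NumberTheory.EllipticCurves.HeegnerDatum (W.conductorNorm ℤ) (NumberField.discr K))
    (ιC : K →+* ℂ) (P : (W.baseChange K).toAffine.Point),
    WeierstrassCurve.Affine.Point.map ιC.toRatAlgHom P =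
    Literature.NumberTheory.EllipticCurves.ModularForms.heegnerPointComplex Dt H →
    (W.baseChange K).mordellWeilRank = 1 →
    Finite (AddCommGroup.primaryComponent (W.baseChange K).sha p) → ¬ IsOfFinAddOrder P →
    ∃ n : ℕ, Summit.BirchSwinnertonDyer.Rank1Residual.X11b.AcSelmer.XAc.HasCharValuationAt
    (W.baseChange K) p κ (Summit.BirchSwinnertonDyer.Rank1Residual.X11b.inducedPlace ι) ∅ γ n ∧
    (n : ℤ) ≤ 2 * (Summit.BirchSwinnertonDyer.Rank1Residual.X11b.padicLogOrd W p ι P +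
    (padicValInt p (1 - W.frobeniusTrace p + p) : ℤ) - 1)) →
    ∀ (W : WeierstrassCurve ℚ) [W.IsElliptic] [W.IsGloballyMinimal] [NeZero (W.conductorNorm ℤ)] (p : ℕ) [Fact p.Prime], Literature.NumberTheory.EllipticCurves.Rank1Residual.ClassX10 W p → ¬ Literature.NumberTheory.EllipticCurves.Rank1Residual.Surj W 3 → ¬ W.HasCM → W.analyticRank = 1 → ∃ B : ℕ, ∀ (K : Type) [Field K] [NumberField K] (Dt : Literature.NumberTheory.EllipticCurves.ModularForms.ModularParametrizationData W (W.conductorNorm ℤ)) (β : ℤ) (ι : K →+* ℂ), Literature.NumberTheory.EllipticCurves.IsImaginaryQuadratic K → B < (NumberField.discr K).natAbs → NumberField.discr K % 8 = 1 → Literature.NumberTheory.EllipticCurves.SatisfiesHeegnerHypothesis (W.conductorNorm ℤ) K → Literature.NumberTheory.EllipticCurves.SatisfiesHeegnerHypothesis p K → (4 * (W.conductorNorm ℤ : ℤ)) ∣ β ^ 2 - NumberField.discr K → ¬ (p : ℤ) ∣ Dt.c → ∀ (d₁ : Literature.NumberTheory.EllipticCurves.KolyvaginHeegnerData Dt β ι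 1), ¬ IsOfFinAddOrder d₁.derivedPoint → ∀ (s : ℕ), (∀ (q : ℕ) [Fact q.Prime], q ∣ W.conductorNorm ℤ → padicValNat p ((W.baseChange ℚ_[q]).localTamagawaNumber ℤ_[q]) < s) → s ≤ padicValNat p W.tamagawaProduct → ∀ (n : ℕ) (d : Literature.NumberTheory.EllipticCurves.KolyvaginHeegnerData Dt β ι n), Squarefree n → (∀ ℓ ∈ n.primeFactors, Literature.NumberTheory.EllipticCurves.Zhang2014.IsKolyvaginPrime (W.conductorNorm ℤ) W K p ℓ ∧ s ≤ Literature.NumberTheory.EllipticCurves.Zhang2014.kolyvaginIndex W p ℓ) → ∃ Q : (W.baseChange (Literature.NumberTheory.EllipticCurves.ringClassField K ι n)).toAffine.Point, ((p ^ s : ℕ) : ℤ) • Q = d.derivedPoint :=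
  fun hU ↦ UpperHalf.beyondCarrierDepthX10b_of_namedFacts_of_upperLink h331 hChaL hKo hU

/-- **THE CENSUS THEOREM of crux 23055 (line «twins», skeleton v5): `BeyondCarrierDepthX10b` BY NAME from
its ONE open stub `stub_upperLink_divisibleClassNumber` (`h₂`: the one-sided link U₃ on the `3 ∣ h_K`
frames) and five cite-only facts** — `h46`/`hYZ`/`h331` close the `3 ∤ h_K` half of U₃ (stub₁), the two
halves merge by cases on `3 ∣ h_K`, and `h331`/`hChaL`/`hKo` turn U₃ into the crux (stub₃). So, in the
kernel: 23055 ⟸ U₃[3 ∣ h_K] ∧ (MZ26 Cor 4.6, YZ composite — unpinned, (T1) pending —, JSW 3.3.1, Cha Rmk 25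
lower, Kolyvagin A). Conditional; beyond-print theorem: no (`h₂` is beyond print).
[cite: MastellaZerman2026, Cor. 4.6] [cite: YanZhu2024MainConjNonCM, Thm. 5.7 (1), Thm. 5.9]
[cite: JetchevSkinnerWan2017, Thm. 3.3.1] [cite: Cha2005, Thm. 21 and Rmk. 25] [cite: Kolyvagin1990, Thm. A] -/
theorem beyondCarrierDepthX10b_of_upperLinkDivisible_of_namedFacts
    (h46 : MastellaZerman2026.cor46_howardDivisibility_of_scalarImage.{0})
    (hYZ : thm57_thm59_bcs422_cgls513_generator_constantCoeff_of_heegnerDivisibility)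
    (h331 : thm331_anticyclotomicControl)
    (hChaL : Cha2005.rmk25_pow_dvd_card_sha_primary_of_certificate)
    (hKo : ∀ (N : ℕ) [NeZero N] (W : WeierstrassCurve ℚ) (K : Type) [Field K] [NumberField K],
      kolyvagin N W K)
    (h₂ : ∀ (W : WeierstrassCurve ℚ) [W.IsElliptic] [W.IsGloballyMinimal] (p : ℕ) [Fact p.Prime]
      [NeZero (W.conductorNorm ℤ)] (K : Type) [Field K] [NumberField K],
      Literature.NumberTheory.EllipticCurves.Rank1Residual.ClassX10 W p →
      ¬ Literature.NumberTheory.EllipticCurves.Rank1Residual.Surj W 3 → ¬ W.HasCM →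
      Literature.NumberTheory.EllipticCurves.IsImaginaryQuadratic K → Odd (NumberField.discr K) →
      NumberField.discr K ≠ -3 →
      Literature.NumberTheory.EllipticCurves.SatisfiesHeegnerHypothesis (W.conductorNorm ℤ) K →
      Literature.NumberTheory.EllipticCurves.SatisfiesHeegnerHypothesis p K →
      p ∣ NumberField.classNumber K →
      (W.baseChange K).HasIrreducibleModPGaloisRep p →
      ∀ (ι : K →+* ℚ_[p]) (κ : Literature.NumberTheory.EllipticCurves.ZpExtension K p), κ.IsAnticyclotomic →
      ∀ (γ : Field.absoluteGaloisGroup K) [Fact (κ.IsTopGenerator γ)]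
      (Dt : Literature.NumberTheory.EllipticCurves.ModularForms.ModularParametrizationData W
      (W.conductorNorm ℤ)), ¬ (p : ℤ) ∣ Dt.c →
      ∀ (H : Literature.NumberTheory.EllipticCurves.HeegnerDatum (W.conductorNorm ℤ) (NumberField.discr K))
      (ιC : K →+* ℂ) (P : (W.baseChange K).toAffine.Point),
      WeierstrassCurve.Affine.Point.map ιC.toRatAlgHom P =
      Literature.NumberTheory.EllipticCurves.ModularForms.heegnerPointComplex Dt H →
      (W.baseChange K).mordellWeilRank = 1 →
      Finite (AddCommGroup.primaryComponent (W.baseChange K).sha p) → ¬ IsOfFinAddOrder P →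
      ∃ n : ℕ, Summit.BirchSwinnertonDyer.Rank1Residual.X11b.AcSelmer.XAc.HasCharValuationAt
      (W.baseChange K) p κ (Summit.BirchSwinnertonDyer.Rank1Residual.X11b.inducedPlace ι) ∅ γ n ∧
      (n : ℤ) ≤ 2 * (Summit.BirchSwinnertonDyer.Rank1Residual.X11b.padicLogOrd W p ι P +
      (padicValInt p (1 - W.frobeniusTrace p + p) : ℤ) - 1)) :
    BeyondCarrierDepthX10b := by
  refine stub_beyondCarrier_of_upperLink_of_namedFacts h331 hChaL hKo ?_
  intro W _ _ p _ _ K _ _ hX hns hcm hK hodd h3 hHN hHp hirr ι κ hκ γ _ Dt hc H ιC P hP hrk hfin hPinf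
  by_cases hh : p ∣ NumberField.classNumber K
  · exact h₂ W p K hX hns hcm hK hodd h3 hHN hHp hh hirr ι κ hκ γ Dt hc H ιC P hP hrk hfin hPinf
  · exact stub_upperLink_coprimeClassNumber_of_namedFacts h46 hYZ h331 W p K hX hns hcm hK hodd h3 hHN hHp
      hh hirr ι κ hκ γ Dt hc H ιC P hP hrk hfin hPinf

end Summit.BirchSwinnertonDyer.BirchSwinnertonDyer.Cruxes.BeyondCarrierDepthX10b.HowardFrames

end
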